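import Literature.MathematicalPhysics.QuantumFieldTheory.Balaban1983to89.B7SectCDGaugeAveragesRec
import Literature.MathematicalPhysics.QuantumFieldTheory.Balaban1983to89.B7Eq214General
import Literature.MathematicalPhysics.QuantumFieldTheory.Balaban1983to89.B7Prop3GeneralTild
import Literature.MathematicalPhysics.QuantumFieldTheory.Balaban1983to89.B7Prop4GeneralLevels
import Literature.MathematicalPhysics.QuantumFieldTheory.Balaban1983to89.B7Eq78Linearization

/-!
# `Balaban1983to89.B7SectEFLinearisationRec` — [Balaban1985Averaging] Sect. E–G (110)–(127), (166)–(167), (178)–(180), (211)–(213) FOR THE RECORD's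
# AVERAGING STRUCTURE ([Balaban1987RG1] (0.3)–(0.4)): the flat frames and double-bar average (110)∕(120), the linear parts (112)∕(122)∕(125) and
# their iterates (127), the first-order objects (114)–(119) of (0.4) OVER THE LOOP FAMILY, the classes `Λ_k(U₀, α₃)` (166)–(167), the
# operators `Q′_j` (211)–(213) and the averages `ũ′ʲ` (178)–(179) — DEFINITION TWINS, on the `ℤᵈ` carriers, of the engine's `B7Prop3Flat` ∕
# `B7Prop3GeneralLinear` ∕ `B7Prop3GeneralTild` ∕ `B7Prop4Flat` ∕ `B7Prop4GeneralLevels` ∕ `B7Eq167Flat` ∕ `B7Eq214General` ∕ `B7Prop9∕10General` objects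

statement-level skeleton of published theorems with citation tags; proofs where landed; nothing here is a claim about the Yang–Mills mass gap

CITATION HEADER (lean-in-tree rule).  Cell `pub-ymgap`, seat `pub-ymgap-dag-n05-e` g35 (LEAD PEN of the «N05-REC» cell, director-ym №254∕№255, plan g90 SIZING
WORD 2026-08-29); module R0b-2 of the road's definitions stage (R0a = `BlockAveragingZd` p690042, R0b-1 = `B7SectCDGaugeAveragesRec`).  `--kind definition
--supports stmt-QuantumFields-20541` (K0⁷; count-neutral).  Sources READ: [3] = [Balaban1985Averaging] pp. 34–38, 44–50 (`paper:balaban1985-cmp98-averaging`, journal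
page = PDF page + 16) through the engine modules named below; [I] = [Balaban1987RG1] (0.3)–(0.4) pp. 252–253 (`paper:balaban1987-cmp109-rg-i-small-field` p0004–p0005).
TOKEN RULE (LEAD brief `HOME/pub-ymgap-dag-n05-e/N05-REC-LEAD.md` §2, as in R0b-1): (T1) `bavg ∕ Xavg ∕ Wcx ∕ avgIter ↦ bavgZ ∕ XZ ∕ WZ ∕ avgIterZ` — in THIS file
(T1) changes an INDEX STRUCTURE once: the first-order objects (114)–(119) of the average run over the loop FAMILY `IdxZ d L` of (0.4) (`AloopZ`,
`DXavgZ`, `QprimeCovZ`, written by hand); (T2) block points `+ boxVec L r ↦ + offZ L r`; (T3) frames∕rotations along the single staircase `treeWord (offZ L r)`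
from the centre.  All other definitions are the engine text under these substitutions (generated, then checked); names = engine name + `Z`;
structure-free helpers (`asum`, `tsum`, `conjR`, `cj`, `bmean`, `Dmlog`, `PhiY`, `expCfg`, `R0fun`, `mlog`, `expUnit`) REUSED BY NAME.
WHAT IS DEFINED (bodies; engine twin in brackets): §1 (110)∕(82) `FavgZ`, `vframeZ`, (89)∕(120) flat `dbavgZ`, (112) `FhatZ`, (122)∕(125) `linQZ`, `Q0formZ`
[`B7Prop3Flat`], (127) flat `linQIterZ` [`B7Prop4Flat`]; §2 (112) `FhatCovZ`, (125) `Q0covZ`, (121) `QcovZ`, (122) `linQcovZ`, `CcovZ` [`B7Prop3GeneralLinear`]; §3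
(114)–(119) `AloopZ`, `DXavgZ`, `QprimeCovZ` [`B7Prop3GeneralTild`]; §4 (127) `logCovIterZ`, `linCovIterZ` [`B7Prop4GeneralLevels`]; §5 (166)–(167) `Cond166Z`, `Cond167Z`,
`InLambdaZ` [`B7Eq167Flat`]; §6 (211)–(213) `rlamZ`, `lamAvgGZ` [`B7Eq214General`]; §7 (178)–(180) `CovBlockBdZ`, `vtilGZ`, `utilGZ` [`B7Prop9General`, `B7Prop10General`];
§8 `rfl` equations; §9 the CENTRED `Blocking` `zdBlockingZ` (`blockSitesZ`, `mem_blockSitesZ`) and the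
level transporters from the centre `bgTZ` [`B7Eq78Linearization.zdBlocking`, `B8Eq119TwistedAxial.bgT`] for [6] (1.29)'s generic `Rbar ∕ QprimeIter`; §10 the GUARDED (78)–(80) of record `savgZG`, `R0avgZG`,
`uavgZG` (+ `savgZG_eq_savgZ_of_small`) for the R7 bridge to `Node00.ShearedAveragingFlat.gaugeAvgIter (loopAvgBlockOp expMeanLogSU)`.  NOT twinned (reused by name): `B7Prop9General.gauge2` (two-block axial gauge rooted at a base point — structure-shared, (T3)).
HONEST SCOPE.  Definitions + `rfl` bookkeeping; NO inequality of [3]∕[6]∕[I] (in particular NOT Prop. 3's (123)∕(126) nor (214) for these objects — that is the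
road's item R1); `HThm4Rec` UNDISCHARGED; N05 ∕ N07 NOT discharged; counts unmoved (typed 28∕28 · discharged 7∕28); one finite 𝕋⁴ programme at fixed ε —
nothing continuum ∕ ℝ⁴ ∕ OS ∕ mass gap ∕ Clay.  No `instance`, no `notation`, no `sorry`.
-/

set_option autoImplicit false

noncomputable section

open scoped BigOperators

namespace Literature.MathematicalPhysics.QuantumFieldTheory.Balaban1983to89.B7SectEFLinearisationRec

open B7Prop1Explicit (Letter e hol treeWord boxVec expUnit seg asum axialFn)
open B7Prop1Explicit renaming Site → SiteZ
open B7Prop2Explicit (rescale rescale_apply)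
open B7Prop3Flat (expCfg)
open B7Prop3GeneralRotated (tsum)
open B7Eq78Linearization (conjR)
open B7Eq92Concrete (Rc tHol mgauge)
open B7Eq99Concrete (R0fun)
open B7Eq170Flat (cj bmean)
open B12AverageCorridor267 (Dmlog PhiY)
open MatrixLog (mlog)
open BlockAveragingZd (offZ IdxZ WZ XZ bavgZ avgIterZ)
open B7SectCDGaugeAveragesRec (dbavgCovZ uavgZ R0avgZ)
open T4Continuum (loopWord)

variable {d : ℕ}

section Twins

variable {𝔸 : Type*} [NormedRing 𝔸] [NormedAlgebra ℂ 𝔸] [CompleteSpace 𝔸] (L : ℕ)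

-- twin of `B7Prop3Flat.Favg`
/-- (RECORD TWIN: centred blocks `offZ`, symmetric (0.4) average `bavgZ`∕`avgIterZ`.) **(110) at `V₀ = 1`, the exponent**: `F(y) := Σ_{x∈B(y)} L^{−d} log V₁(Γ_{y,x})` (`y = q`, `x = q + r`,
`Γ_{y,x}` = `treeWord r` based at `q`; at `V₀ = 1`, `(R_{0,y}V₁)(Γ_{y,x}) = V₁(Γ_{y,x})` by (58)). [cite: Balaban1985Averaging, (110) p.34, (82) p.30, (58) p.27] -/
def FavgZ (V : SiteZ d → Fin d → 𝔸ˣ) (q : SiteZ d) : 𝔸 :=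
  ∑ r : Fin d → Fin L, (((L : ℝ) ^ d)⁻¹) • mlog ((hol V q (treeWord (offZ L r)) : 𝔸ˣ) : 𝔸)

-- twin of `B7Prop3Flat.vframe`
/-- (RECORD TWIN: centred blocks `offZ`, symmetric (0.4) average `bavgZ`∕`avgIterZ`.) **(110)/(82) at `V₀ = 1`**: the block frame `v(y) := \overline{R_{0,y}V₁} = exp F(y)` — the one-step average (78) of the
gauge function `x ↦ V₁(Γ_{y,x})` on the block `B(y)`. [cite: Balaban1985Averaging, (110) p.34, (82) p.30] -/
def vframeZ (V : SiteZ d → Fin d → 𝔸ˣ) (q : SiteZ d) : 𝔸ˣ := expUnit (FavgZ L V q)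

-- twin of `B7Prop3Flat.dbavg`
/-- (RECORD TWIN: centred blocks `offZ`, symmetric (0.4) average `bavgZ`∕`avgIterZ`.) **(89)/(90)/(120) at `V₀ = 1`, the "double-bar" average**: `V̿₁(c) := v(c₋)⁻¹ · V̄₁(c) · v(c₊)` for the `L`-bond
`c = ⟨q, q + Le_κ⟩` (`V̄₀ = 1`, `R̄_{0,c} = id`, `Ṽ₁ = V̄₁` = the average (42) `bavg`). [cite: Balaban1985Averaging, (89)–(90) p.31, (120) p.35] -/
def dbavgZ (V : SiteZ d → Fin d → 𝔸ˣ) : SiteZ d → Fin d → 𝔸ˣ := fun q κ =>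
  (vframeZ L V q)⁻¹ * bavgZ L V q κ * vframeZ L V (q + (L : ℤ) • e κ)

-- twin of `B7Prop3Flat.Fhat`
/-- (RECORD TWIN: centred blocks `offZ`, symmetric (0.4) average `bavgZ`∕`avgIterZ`.) **The exponent of (112) at `V₀ = 1`**: `F̂(y) := Σ_{x∈B(y)} L^{−d} A(Γ_{y,x})` (`(R_{0,y}A)(Γ_{y,x}) = A(Γ_{y,x})` at
`V₀ = 1`), the linearisation of `F(y)`. [cite: Balaban1985Averaging, (111)–(112) p.34] -/
def FhatZ (A : SiteZ d → Fin d → 𝔸) (q : SiteZ d) : 𝔸 :=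
  ∑ r : Fin d → Fin L, (((L : ℝ) ^ d)⁻¹) • asum A q (treeWord (offZ L r))

-- twin of `B7Prop3Flat.linQ`
/-- (RECORD TWIN: centred blocks `offZ`, symmetric (0.4) average `bavgZ`∕`avgIterZ`.) **`L·(Q₀A)_c`** = `Σ_{x∈B(c₋)} L^{−d} A([x, x′])`, `x′ = x + Le_κ` — the linear part (122) of `(1/i) log V̿₁(c)` at `V₀ = 1`
(READING C-adv4-22 of «L(Q(V₀)A)_c»; cf. p. 28 "`(Q₀A)(c) = Σ_{x∈B(c₋)} L^{−d}(R_{0,c₋}A)([x, x(c)])`"). [cite: Balaban1985Averaging, (122) p.36, p.28] -/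
def linQZ (A : SiteZ d → Fin d → 𝔸) (q : SiteZ d) (κ : Fin d) : 𝔸 :=
  ∑ r : Fin d → Fin L, (((L : ℝ) ^ d)⁻¹) • asum A (q + offZ L r) (seg κ L)

-- twin of `B7Prop3Flat.Q0form`
/-- (RECORD TWIN: centred blocks `offZ`, symmetric (0.4) average `bavgZ`∕`avgIterZ`.) **(125) verbatim normalisation**: `(Q₀A)_c = Σ_{x∈B(c₋)} L^{−(d+1)} A([x, x′])` (at `V₀ = 1`, `R_{0,c₋}A = A`) — "it resembles
the definition of the averaging operation `Q` in [2]" (B5 (1.11)). [cite: Balaban1985Averaging, (125) p.36] -/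
def Q0formZ (A : SiteZ d → Fin d → 𝔸) (q : SiteZ d) (κ : Fin d) : 𝔸 :=
  ∑ r : Fin d → Fin L, (((L : ℝ) ^ (d + 1))⁻¹) • asum A (q + offZ L r) (seg κ L)

-- twin of `B7Prop4Flat.linQIter`
/-- (RECORD TWIN: centred blocks `offZ`, symmetric (0.4) average `bavgZ`∕`avgIterZ`.) **`Q_j(U₀)` at `U₀ = 1`, the composition of the linear parts of the first `j` functions (127)** — p. 38: "denoting
… Q_{j+1}(U₀) = Q(Ū₀^j)Q_j(U₀)", at `U₀ = 1` where every `Q(Ū₀^j) = Q₀` (125) — in the un-normalised form `L^jη·Q_j(1)A`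
of (130) and read on the unit lattice after `j` rescalings: `linQIterZ L B 0 = B`,
`linQIterZ L B (j+1) (z, κ) = L·(Q₀ (linQIterZ L B j))` at the `L`-bond `⟨Lz, Lz + Le_κ⟩`. [cite: Balaban1985Averaging, (127) p.37, p.38 (before (133)), (125) p.36] -/
def linQIterZ (L : ℕ) (B : SiteZ d → Fin d → 𝔸) : ℕ → SiteZ d → Fin d → 𝔸
  | 0 => B
  | j + 1 => fun z κ => linQZ L (linQIterZ L B j) ((L : ℤ) • z) κ

-- twin of `B7Prop3GeneralLinear.FhatCov`
/-- (RECORD TWIN: centred blocks `offZ`, symmetric (0.4) average `bavgZ`∕`avgIterZ`.) **the exponent of (112) at the background `V₀`**: `F̂_{V₀}(y) := Σ_{x∈B(y)} L^{−d} (R_{0,y}A)(Γ_{y,x})`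
("\overline{R_{0,y}V₁} = exp[i Σ_{x∈B(y)} L^{−d}(R_{0,y}A)(Γ_{y,x}) + O(L²α₁²)]"); at `V₀ = 1` it is `B7Prop3Flat.Fhat`.
[cite: Balaban1985Averaging, (112) p.34] -/
def FhatCovZ (V₀ : SiteZ d → Fin d → 𝔸ˣ) (A : SiteZ d → Fin d → 𝔸) (y : SiteZ d) : 𝔸 :=
  ∑ r : Fin d → Fin L, (((L : ℝ) ^ d)⁻¹) • tsum V₀ A y (treeWord (offZ L r))

-- twin of `B7Prop3GeneralLinear.Q0cov`
/-- (RECORD TWIN: centred blocks `offZ`, symmetric (0.4) average `bavgZ`∕`avgIterZ`.) **(125)** "(Q₀A)_c = (Q_{V₀}A)_c = Σ_{x∈B(c₋)} L^{−(d+1)}(R_{0,c₋}A)([x, x′])" for the `L`-bond `c = ⟨q, q + Le_κ⟩`,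
`x = q + r ∈ B(c₋)`, `x′ = x + Le_κ`: the straight segment `[x, x′]` (`seg κ L`) summed with the rotations
`R_{0,c₋}` transported from `c₋` along the tree contour `Γ_{c₋,x}` (`treeWord r`) — i.e. the `[x, x′]`-piece of
`(R_{0,c₋}A)(Γ_{c₋,x} ∪ [x, x′])` (`tsum_append`). At `V₀ = 1` it is `B7Prop3Flat.Q0form`. "it resembles the definition
of the averaging operation Q in [2]". [cite: Balaban1985Averaging, (125) p.36] -/
def Q0covZ (V₀ : SiteZ d → Fin d → 𝔸ˣ) (A : SiteZ d → Fin d → 𝔸) (q : SiteZ d) (κ : Fin d) : 𝔸 :=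
  ∑ r : Fin d → Fin L, (((L : ℝ) ^ (d + 1))⁻¹) •
    conjR (hol V₀ q (treeWord (offZ L r))) (tsum V₀ A (q + offZ L r) (seg κ L))

-- twin of `B7Prop3GeneralLinear.Qcov`
/-- (RECORD TWIN: centred blocks `offZ`, symmetric (0.4) average `bavgZ`∕`avgIterZ`.) **(121)** "Q(V₀, A, c) = (1/i) log(V̿₁)_c" for the double-bar average (89) at the background `V₀`
(`B7Eq92Concrete.dbavgCov`) of the configuration `V₁ = e^{A}` (109) (`B7Prop3Flat.expCfg`; the `i` absorbed into `A`,
`log` = the series (21), lineage conventions); at `V₀ = 1` it is `mlog (dbavgZ L (expCfg A) q κ)` of `B7Prop3Flat`.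
[cite: Balaban1985Averaging, (121) p.36] -/
def QcovZ (V₀ : SiteZ d → Fin d → 𝔸ˣ) (A : SiteZ d → Fin d → 𝔸) (q : SiteZ d) (κ : Fin d) : 𝔸 :=
  mlog ((dbavgCovZ L V₀ (expCfg A) q κ : 𝔸ˣ) : 𝔸)

-- twin of `B7Prop3GeneralLinear.linQcov`
/-- (RECORD TWIN: centred blocks `offZ`, symmetric (0.4) average `bavgZ`∕`avgIterZ`.) **(122), the linear part «L(Q(V₀)A)_c»** — "then Q(V₀, A, c) is an analytic function of A and from (120) it follows
that its Taylor expansion begins with a first-order polynomial. Let us denote it by L(Q(V₀)A)_c" — typed as the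
first-order Taylor term along the ray through `A`: the `t`-derivative at `0` of `t ↦ Q(V₀, tA, c)` (Mathlib `deriv`;
for the analytic `Q` of Prop. 3 this is the printed first-order polynomial evaluated at `A`; READING C-adv4-22: it equals
`L·(Q(V₀)A)_c` with `L` the block size, (124)–(126) bounding the `L^{−(d+1)}`-normalised form). Its closed form (124)
and the bound (126) are the sequel's; at `V₀ = 1` it is `B7Prop3Flat.linQ` (`linQcov_one_left`). [cite: Balaban1985Averaging, (122) p.36] -/
def linQcovZ (V₀ : SiteZ d → Fin d → 𝔸ˣ) (A : SiteZ d → Fin d → 𝔸) (q : SiteZ d) (κ : Fin d) : 𝔸 :=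
  deriv (fun t : ℂ => QcovZ L V₀ (t • A) q κ) 0

-- twin of `B7Prop3GeneralLinear.Ccov`
/-- (RECORD TWIN: centred blocks `offZ`, symmetric (0.4) average `bavgZ`∕`avgIterZ`.) **(122), the remainder** "C(V₀, A, c) is an analytic function of A whose Taylor's expansion begins with a
second-order polynomial": typed as the difference `Q(V₀, A, c) − L(Q(V₀)A)_c`, so that (122)
"Q(V₀, A, c) = L(Q(V₀)A)_c + C(V₀, A, c)" holds by definition (`Qcov_eq_linQcov_add_Ccov`); its bound (123) is the
analyticity half of Prop. 3, not made here. [cite: Balaban1985Averaging, (122)–(123) p.36] -/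
def CcovZ (V₀ : SiteZ d → Fin d → 𝔸ˣ) (A : SiteZ d → Fin d → 𝔸) (q : SiteZ d) (κ : Fin d) : 𝔸 :=
  QcovZ L V₀ A q κ - linQcovZ L V₀ A q κ


/-! ### (114)–(119): the first-order objects of (0.4) itself — the loop family replaces the single contour (TOKEN RULE (T1)) -/

/-- (RECORD TWIN, (T1): the loop FAMILY of (0.4).) **(114)∕(115) to first order** for the record average: the rotated functional
`(R_{0,c₋}A)` along the CLOSED loop `Γ ∪ [x,x′] ∪ (−Γ′) ∪ (−c)` of (0.4) (NODE 00's `loopWord`, from the block centre `q`) indexed by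
`i = (r, σ, σ′) : IdxZ d L` — the engine's `Aloop` has the single loop `Γ_{c,x} ∪ (−c)`. [cite: Balaban1985Averaging, (114)–(115) p.34; Balaban1987RG1, (0.4) p.253] -/
def AloopZ (V₀ : SiteZ d → Fin d → 𝔸ˣ) (A : SiteZ d → Fin d → 𝔸) (q : SiteZ d) (κ : Fin d) (i : IdxZ d L) : 𝔸 :=
  tsum V₀ A q (loopWord L κ (offZ L i.1) i.2.1 i.2.2)

/-- (RECORD TWIN, (T1).) **The first exponent of (117), to first order**, for the record average: the `t`-derivative at `0` of the
exponent `XZ` of (0.4) along `e^{tA}V₀` is `Σ_i |IdxZ|⁻¹ (D log)_{W_i(V₀)}(A_i^{(1)}·W_i(V₀))`, `W_i = WZ … i` the loop variables.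
[cite: Balaban1985Averaging, (117) p.35; Balaban1987RG1, (0.4) p.253] -/
def DXavgZ (V₀ : SiteZ d → Fin d → 𝔸ˣ) (A : SiteZ d → Fin d → 𝔸) (q : SiteZ d) (κ : Fin d) : 𝔸 :=
  ∑ i : IdxZ d L, ((Fintype.card (IdxZ d L) : ℝ))⁻¹ •
    Dmlog ((WZ L V₀ q κ i : 𝔸ˣ) : 𝔸) (AloopZ L V₀ A q κ i * ((WZ L V₀ q κ i : 𝔸ˣ) : 𝔸))

/-- (RECORD TWIN, (T1).) **(119) `(Q′(V₀)A)_c`** for the record average — the engine's `QprimeCov` with `Xavg ↦ XZ`, `DXavg ↦ DXavgZ`: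
`g(−i ad_Y)[DXavgZ] + R(e^{iY})(R_{0,c₋}A)(c)`, `iY = XZ` the exponent of (0.4). [cite: Balaban1985Averaging, (119) p.35, (117)–(118) p.35] -/
def QprimeCovZ (V₀ : SiteZ d → Fin d → 𝔸ˣ) (A : SiteZ d → Fin d → 𝔸) (q : SiteZ d) (κ : Fin d) : 𝔸 :=
  PhiY (XZ L V₀ q κ) (DXavgZ L V₀ A q κ) + conjR (expUnit (XZ L V₀ q κ)) (tsum V₀ A q (seg κ L))

-- twin of `B7Prop4GeneralLevels.logCovIter`
/-- (RECORD TWIN: centred blocks `offZ`, symmetric (0.4) average `bavgZ`∕`avgIterZ`.) **«Q_j(U₀, ηA)», the composition of the first `j` functions (127)** at a GENERAL background — p. 38: «denoting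
Q_{j+1}(U₀, ηA) = Q(Ū₀ʲ, Q_j(U₀, ηA))» —, each factor being the one-step map (121) `Qcov` of `B7Prop3GeneralLinear`
(`(1/i) log V̿₁` at the background `Ū₀ʲ = avgIterZ L U₀ j`, (89)/(91)), read on the unit lattice after `j` rescalings:
`logCovIterZ L U₀ B 0 = B`, `logCovIterZ L U₀ B (j+1) (z, κ) = Q(Ū₀ʲ, logCovIterZ L U₀ B j)` at the `L`-bond `⟨Lz, Lz + Le_κ⟩`.
At `U₀ = 1` it is `B7Prop4Flat.logIter` (`logCovIter_one_left`). [cite: Balaban1985Averaging, (127) p.37, p.38 (before (133)), (121) p.36] -/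
def logCovIterZ (L : ℕ) (U₀ : SiteZ d → Fin d → 𝔸ˣ) (B : SiteZ d → Fin d → 𝔸) :
    ℕ → SiteZ d → Fin d → 𝔸
  | 0 => B
  | j + 1 => fun z κ => QcovZ L (avgIterZ L U₀ j) (logCovIterZ L U₀ B j) ((L : ℤ) • z) κ

-- twin of `B7Prop4GeneralLevels.linCovIter`
/-- (RECORD TWIN: centred blocks `offZ`, symmetric (0.4) average `bavgZ`∕`avgIterZ`.) **«L^jη·Q_j(U₀)A», the composition of the linear parts** — p. 38: «Q_{j+1}(U₀) = Q(Ū₀ʲ)Q_j(U₀)» —, un-normalised,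
each factor being (122)'s linear part `linQcov` of `B7Prop3GeneralLinear` at the background `Ū₀ʲ`.
[cite: Balaban1985Averaging, p.38 (before (133)), (122) p.36] -/
def linCovIterZ (L : ℕ) (U₀ : SiteZ d → Fin d → 𝔸ˣ) (B : SiteZ d → Fin d → 𝔸) :
    ℕ → SiteZ d → Fin d → 𝔸
  | 0 => B
  | j + 1 => fun z κ => linQcovZ L (avgIterZ L U₀ j) (linCovIterZ L U₀ B j) ((L : ℤ) • z) κ

-- twin of `B7Eq167Flat.Cond166`
/-- (RECORD TWIN: centred blocks `offZ`, symmetric (0.4) average `bavgZ`∕`avgIterZ`.) **(166)**: "`|(\overline{R₀u^j})(x_j) − 1| < α₃, x_j ∈ Ω^{(j)}, j = 0, 1, …, k`" — the `j`-th order averages (79)–(80)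
`\overline{R₀u}^j` (print's overline spans `R₀u^j`; `B7Eq84Concrete.uavg … j`, a function on the level-`j` lattice `Ω^{(j)}`, here
all of `ℤ^d` in level-`j` coordinates) stay within `α₃` of `1`; `≤` for `<`. [cite: Balaban1985Averaging, (166) p.44, (79)–(80) p.30] -/
def Cond166Z (L : ℕ) (U₀ : SiteZ d → Fin d → 𝔸ˣ) (u : SiteZ d → 𝔸ˣ) (k : ℕ) (α₃ : ℝ) : Prop :=
  ∀ j ≤ k, ∀ z : SiteZ d, ‖((uavgZ L U₀ u j z : 𝔸ˣ) : 𝔸) - 1‖ ≤ α₃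

-- twin of `B7Eq167Flat.Cond167`
/-- (RECORD TWIN: centred blocks `offZ`, symmetric (0.4) average `bavgZ`∕`avgIterZ`.) **(167)**: "`|(\overline{R₀u^j})⁻¹(x_{j+1})(R̄^j_{0,x_{j+1}}\overline{R₀u^j})(x_j) − 1| < α₃L^{j+1}η, x_{j+1} ∈ Ω^{(j+1)},
x_j ∈ B(x_{j+1}), j = 0, 1, …, k − 1`" — `x_{j+1} = z`, `x_j = Lz + r` with `r ∈ [0, L)^d` (the block `B(x_{j+1})`, (78)), and
`(R̄^j_{0,x_{j+1}}w)(x_j) = R(Ū₀^j(Γ_{x_{j+1},x_j}))w(x_j)` the rotation (58) by the transporter of the averaged background `Ū₀^j`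
(`avgIterZ L U₀ j`) along the tree contour `Γ_{x_{j+1},x_j}` (`treeWord`); `η` is a free parameter (print: `η = L^{−k}`);
`≤` for `<`. [cite: Balaban1985Averaging, (167) p.44, (58) p.27, (78) p.30] -/
def Cond167Z (L : ℕ) (U₀ : SiteZ d → Fin d → 𝔸ˣ) (u : SiteZ d → 𝔸ˣ) (k : ℕ) (α₃ η : ℝ) : Prop :=
  ∀ j < k, ∀ (z : SiteZ d) (r : Fin d → Fin L),
    ‖(((uavgZ L U₀ u j ((L : ℤ) • z))⁻¹
        * Rc (hol (avgIterZ L U₀ j) ((L : ℤ) • z) (treeWord (offZ L r)))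
            (uavgZ L U₀ u j ((L : ℤ) • z + offZ L r)) : 𝔸ˣ) : 𝔸) - 1‖
      ≤ α₃ * (L : ℝ) ^ (j + 1) * η

-- twin of `B7Eq167Flat.InLambda`
/-- (RECORD TWIN: centred blocks `offZ`, symmetric (0.4) average `bavgZ`∕`avgIterZ`.) **`u ∈ Λ_k(U₀, α₃)`** (p. 44): "`Λ_k(U₀, α₃)` is a set of gauge transformations `u` defined on `Ω`, and satisfying the
conditions (166), (167)". [cite: Balaban1985Averaging, (166)–(167) p.44] -/
def InLambdaZ (L : ℕ) (U₀ : SiteZ d → Fin d → 𝔸ˣ) (u : SiteZ d → 𝔸ˣ) (k : ℕ) (α₃ η : ℝ) : Prop :=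
  Cond166Z L U₀ u k α₃ ∧ Cond167Z L U₀ u k α₃ η

-- twin of `B7Eq214General.rlam`
/-- (RECORD TWIN: centred blocks `offZ`, symmetric (0.4) average `bavgZ`∕`avgIterZ`.) **The main term of (211)**, "`Σ_{x∈B(y)} L^{−d}(R_{0,y}λ)(x)`": the block mean of the rotated `𝔤`-valued site function
`(R_{0,y}f)(x) = R(V₀(Γ_{y,x}))f(x)` (p. 27, display after (59); `x = y + r`, `r ∈ [0, L)^d`, `Γ_{y,x} = treeWord r` from `y`,
`R(X)Y = XYX⁻¹` = `B7Eq170Flat.cj`) — the one-step linear operator `(Q′f)(y)` of (211)–(213) at the background `V₀` (p. 28: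
"`(Q′₀λ)(y) = Σ_{x∈B(y)} L^{−d}(R_{0,y}λ)(x)`", cf. `B7Eq61Linearization.Qp0` over an abstract transport).
[cite: Balaban1985Averaging, (211) p.50, p.28, (78) p.30] -/
def rlamZ (L : ℕ) (V₀ : SiteZ d → Fin d → 𝔸ˣ) (f : SiteZ d → 𝔸) (y : SiteZ d) : 𝔸 :=
  bmean L (fun r => cj (hol V₀ y (treeWord (offZ L r))) (f (y + offZ L r)))

-- twin of `B7Eq214General.lamAvgG`
/-- (RECORD TWIN: centred blocks `offZ`, symmetric (0.4) average `bavgZ`∕`avgIterZ`.) **The linear operator `(Q′_jλ)(y) = Σ_{x∈Bʲ(y)} L^{−jd}R(U₀(Γ^{(j)}_{y,x}))λ(x)`** of (212)/(213) at the background `U₀`, defined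
inductively: `Q′₀λ = λ`, `(Q′_{j+1}λ)(z) = Σ_{x∈B(Lz)} L^{−d}R(Ū₀ʲ(Γ_{Lz,x}))(Q′_jλ)(x)` — the composed transports (77) p. 30
"`R(U₀(Γ^{(j+1)}_{x_{j+1},x})) = … R̄ʲ_{0,x_{j+1}} ⋯ R̄_{0,x₂}·R_{0,x₁}`" built level by level from the averaged backgrounds `Ū₀ʲ =
B7Prop2Explicit.avgIterZ L U₀ j`, in the coarse coordinates of (80) (`B7Eq84Concrete.uavg`: the level-`(j+1)` site `z` has block corner
`Lz` on level `j`).  The linear part of `λ ↦ (1/i) log ũ′ʲ` (B8 p. 80: "a linear part of `(1/i) log(R̄₀uʲ)(y)` is equal to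
`(Q′_j(U₀)λ)(y)`"; B9 (3.19)); over the abstract `Blocking` carrier it is `B7Eq78Linearization.QprimeIter`.  At `U₀ = 1`:
`B7Eq214Flat.lamAvg` (`lamAvgG_one_left`). [cite: Balaban1985Averaging, (212)–(213) p.50, (77)–(80) p.30] -/
def lamAvgGZ (L : ℕ) (U₀ : SiteZ d → Fin d → 𝔸ˣ) : ℕ → (SiteZ d → 𝔸) → SiteZ d → 𝔸
  | 0, f => f
  | j + 1, f => fun z => rlamZ L (avgIterZ L U₀ j) (lamAvgGZ L U₀ j f) ((L : ℤ) • z)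

-- twin of `B7Prop9General.CovBlockBd`
/-- (RECORD TWIN: centred blocks `offZ`, symmetric (0.4) average `bavgZ`∕`avgIterZ`.) **(180d) at a general background** (print p. 46: "`|v₁⁻¹(y)(R₀v₁)(x) − 1| < Lα′₃, x ∈ B(y), y ∈ Ω′^{(1)}`"), with
`(R₀v₁)(x) = (R_{0,y}v₁)(x) = R(V₀(Γ_{y,x}))v₁(x)` (`B7Eq99Concrete.R0fun`, the display after (59) p. 27), block corners
`y = Lz`, block points `x = Lz + r`, `r ∈ [0, L)^d`; `β` stands for `Lα′₃`.  This is the `j = 0` instance of the shape of (167)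
(`B7Eq167Flat.Cond167`, cf. `B7Prop8General.cond167_iff_R0fun`); at `V₀ = 1` it is `B7Prop9Flat.BlockBd` (`covBlockBd_one_left`).
[cite: Balaban1985Averaging, (180) p.46, (167) p.44, p.27 (display after (59))] -/
def CovBlockBdZ (L : ℕ) (V₀ : SiteZ d → Fin d → 𝔸ˣ) (v : SiteZ d → 𝔸ˣ) (β : ℝ) : Prop :=
  ∀ (z : SiteZ d) (r : Fin d → Fin L),
    ‖((((v ((L : ℤ) • z))⁻¹ * R0fun V₀ ((L : ℤ) • z) v ((L : ℤ) • z + offZ L r) : 𝔸ˣ)) : 𝔸) - 1‖ ≤ β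

-- twin of `B7Prop9General.vtilG`
/-- (RECORD TWIN: centred blocks `offZ`, symmetric (0.4) average `bavgZ`∕`avgIterZ`.) **`ṽ′` at a general background, fine base point** `y`: `ṽ′(y) = \overline{R₀v′v₁}(y)·(\overline{R₀v₁}(y))⁻¹`, the
one-step operation of (178)/(179) with the twisted averages (78) `B7Eq99Concrete.R0avg` at `V₀` (print indexes `ṽ′` by the
coarse site; here by the block corner `y = Lz`).  At `V₀ = 1`: `B7Prop9Flat.vtil` (`vtilG_one_left`).
[cite: Balaban1985Averaging, (178)–(179) p.45, (78) p.30] -/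
def vtilGZ (L : ℕ) (V₀ : SiteZ d → Fin d → 𝔸ˣ) (v' v₁ : SiteZ d → 𝔸ˣ) (y : SiteZ d) : 𝔸ˣ :=
  R0avgZ L V₀ (v' * v₁) y * (R0avgZ L V₀ v₁ y)⁻¹

-- twin of `B7Prop10General.utilG`
/-- (RECORD TWIN: centred blocks `offZ`, symmetric (0.4) average `bavgZ`∕`avgIterZ`.) **(178)/(179) at a general background `U₀`** (p. 45: "We will consider the averages `ũ′ʲ = \overline{R₀u′u₁}ʲ(\overline{R₀u₁}ʲ)⁻¹`.
(178) … they may be defined inductively as `ũ′¹ = ũ′ = \overline{R₀u′u₁}(\overline{R₀u₁})⁻¹, ũ′^{j+1} =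
\overline{R̄₀ʲũ′ʲ\overline{R₀u₁}ʲ}(\overline{R̄₀ʲ\overline{R₀u₁}ʲ})⁻¹`. (179)"): the inductive form (179), the averages at level `j`
being the twisted block averages (78)/(80) at the averaged background `Ū₀ʲ = B7Prop2Explicit.avgIterZ L U₀ j`, `\overline{R₀u₁}ʲ =
B7Eq84Concrete.uavgZ L U₀ u₁ j`, one step = `B7Prop9General.vtilG`; `ũ′⁰ := u′`.  At `U₀ = 1`: `B7Prop9Flat.util` (`utilG_one_left`).
[cite: Balaban1985Averaging, (178)–(179) p.45, (79)–(80) p.30] -/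
def utilGZ (L : ℕ) (U₀ : SiteZ d → Fin d → 𝔸ˣ) (u' u₁ : SiteZ d → 𝔸ˣ) : ℕ → SiteZ d → 𝔸ˣ
  | 0 => u'
  | j + 1 => fun z => vtilGZ L (avgIterZ L U₀ j) (utilGZ L U₀ u' u₁ j) (uavgZ L U₀ u₁ j) ((L : ℤ) • z)

end Twins

/-! ## §8 Recursion equations (definitional) -/

section Eqns

variable {𝔸 : Type*} [NormedRing 𝔸] [NormedAlgebra ℂ 𝔸] [CompleteSpace 𝔸] (L : ℕ)

omit [CompleteSpace 𝔸] in
/-- `Q₀(1)` iterate: `linQIterZ L B 0 = B`. [cite: Balaban1985Averaging, (127) p.37] -/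
@[simp] theorem linQIterZ_zero (B : SiteZ d → Fin d → 𝔸) : linQIterZ L B 0 = B := rfl

omit [CompleteSpace 𝔸] in
/-- `linQIterZ L B (j+1) (z, κ) = linQZ (linQIterZ L B j) (Lz) κ`. [cite: Balaban1985Averaging, (127) p.37] -/
theorem linQIterZ_succ (B : SiteZ d → Fin d → 𝔸) (j : ℕ) (z : SiteZ d) (κ : Fin d) :
    linQIterZ L B (j + 1) z κ = linQZ L (linQIterZ L B j) ((L : ℤ) • z) κ := rfl

/-- `Q_0(U₀, ·) = id`. [cite: Balaban1985Averaging, (127) p.37] -/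
@[simp] theorem logCovIterZ_zero (U₀ : SiteZ d → Fin d → 𝔸ˣ) (B : SiteZ d → Fin d → 𝔸) : logCovIterZ L U₀ B 0 = B := rfl

/-- `Q_{j+1}(U₀, B) = Q(Ū₀ʲ, Q_j(U₀, B))` at the `L`-bond `⟨Lz, Lz + Le_κ⟩`. [cite: Balaban1985Averaging, p.38 (before (133))] -/
theorem logCovIterZ_succ (U₀ : SiteZ d → Fin d → 𝔸ˣ) (B : SiteZ d → Fin d → 𝔸) (j : ℕ) (z : SiteZ d) (κ : Fin d) :
    logCovIterZ L U₀ B (j + 1) z κ = QcovZ L (avgIterZ L U₀ j) (logCovIterZ L U₀ B j) ((L : ℤ) • z) κ := rfl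

/-- `L⁰η·Q_0(U₀) = id`. [cite: Balaban1985Averaging, (127) p.37] -/
@[simp] theorem linCovIterZ_zero (U₀ : SiteZ d → Fin d → 𝔸ˣ) (B : SiteZ d → Fin d → 𝔸) : linCovIterZ L U₀ B 0 = B := rfl

/-- `Q_{j+1}(U₀) = Q(Ū₀ʲ)Q_j(U₀)` (linear parts) at the `L`-bond `⟨Lz, Lz + Le_κ⟩`. [cite: Balaban1985Averaging, p.38 (before (133)), (122) p.36] -/
theorem linCovIterZ_succ (U₀ : SiteZ d → Fin d → 𝔸ˣ) (B : SiteZ d → Fin d → 𝔸) (j : ℕ) (z : SiteZ d) (κ : Fin d) :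
    linCovIterZ L U₀ B (j + 1) z κ = linQcovZ L (avgIterZ L U₀ j) (linCovIterZ L U₀ B j) ((L : ℤ) • z) κ := rfl

/-- `Q′₀ = id` (212). [cite: Balaban1985Averaging, (212) p.50] -/
@[simp] theorem lamAvgGZ_zero (U₀ : SiteZ d → Fin d → 𝔸ˣ) (f : SiteZ d → 𝔸) : lamAvgGZ L U₀ 0 f = f := rfl

/-- `(Q′_{j+1}λ)(z) = (Q′(Ū₀ʲ) Q′_jλ)(Lz)` (213). [cite: Balaban1985Averaging, (213) p.50] -/
theorem lamAvgGZ_succ (U₀ : SiteZ d → Fin d → 𝔸ˣ) (j : ℕ) (f : SiteZ d → 𝔸) (z : SiteZ d) :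
    lamAvgGZ L U₀ (j + 1) f z = rlamZ L (avgIterZ L U₀ j) (lamAvgGZ L U₀ j f) ((L : ℤ) • z) := rfl

/-- `ũ′⁰ = u′` (179). [cite: Balaban1985Averaging, (179) p.45] -/
@[simp] theorem utilGZ_zero (U₀ : SiteZ d → Fin d → 𝔸ˣ) (u' u₁ : SiteZ d → 𝔸ˣ) : utilGZ L U₀ u' u₁ 0 = u' := rfl

/-- `ũ′^{j+1}(z) = ṽ′(Lz)` with the level-`j` data (179). [cite: Balaban1985Averaging, (179) p.45] -/
theorem utilGZ_succ (U₀ : SiteZ d → Fin d → 𝔸ˣ) (u' u₁ : SiteZ d → 𝔸ˣ) (j : ℕ) (z : SiteZ d) :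
    utilGZ L U₀ u' u₁ (j + 1) z = vtilGZ L (avgIterZ L U₀ j) (utilGZ L U₀ u' u₁ j) (uavgZ L U₀ u₁ j) ((L : ℤ) • z) := rfl

end Eqns

/-! ## §9 The centred block geometry as a `Blocking` and the level transporters from the centre ([3] (78)–(80); for [6] (1.29)'s `Rbar ∕ QprimeIter`) -/

section BlockingZ

variable {𝔸 : Type*} [NormedRing 𝔸] [NormedAlgebra ℂ 𝔸] [CompleteSpace 𝔸]

/-- **The CENTRED block of the coarse site `y`** as a finite set of fine sites: `{L·y + offZ L r : r ∈ {0,…,L−1}ᵈ}` ([I] (0.3) «a block … with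
a center at y»; the engine's `blockSites L y = {L·y + t : 0 ≤ t < L}` is the corner block). [cite: Balaban1987RG1, (0.3) p.252] -/
def blockSitesZ (L : ℕ) (y : SiteZ d) : Finset (SiteZ d) :=
  Finset.univ.image fun r : Fin d → Fin L => (L : ℤ) • y + offZ L r

/-- Membership in the centred block. [cite: Balaban1987RG1, (0.3) p.252] -/
theorem mem_blockSitesZ {L : ℕ} {y x : SiteZ d} : x ∈ blockSitesZ L y ↔ ∃ r : Fin d → Fin L, x = (L : ℤ) • y + offZ L r := by
  simp only [blockSitesZ, Finset.mem_image, Finset.mem_univ, true_and]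
  exact ⟨fun ⟨r, hr⟩ => ⟨r, hr.symm⟩, fun ⟨r, hr⟩ => ⟨r, hr.symm⟩⟩

/-- **(RECORD TWIN of `B7Eq78Linearization.zdBlocking`.) The record's block geometry as a `Blocking` of `ℤᵈ`**: at every level the block of `y`
is the CENTRED block `blockSitesZ L y`, the prefactor of (78) is read at the centre `L·y`, the weights are `L⁻ᵈ` — so that [6] (1.29)'s
`Rbar`∕`QprimeIter` (generic over a `Blocking`) instantiate for the record by `zdBlocking ↦ zdBlockingZ`. [cite: Balaban1985Averaging, (78)–(80) p.30; Balaban1987RG1, (0.3) p.252] -/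
def zdBlockingZ (d L : ℕ) : B7Eq78Linearization.Blocking (Fin d → ℤ) where
  B := fun _ y => blockSitesZ L y
  base := fun _ y => (L : ℤ) • y
  wt := fun _ _ _ => ((L : ℝ) ^ d)⁻¹

/-- **(RECORD TWIN of `B8Eq119TwistedAxial.bgT`.) The level transporters of the background from the CENTRE**: `T_j(y, x) = Ū₀ʲ(Γ_{L·y,x})`,
the axial function of the `j`-fold record average `avgIterZ` rooted at the block centre `L·y` along the (1.7) staircase ((T3): the
staircase itself is the engine's `axialFn ∕ treeWord`). [cite: Balaban1985Averaging, (78)–(80) p.30; Balaban1985RegularSpaces, (1.29) p.81] -/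
def bgTZ (L : ℕ) (U₀ : SiteZ d → Fin d → 𝔸ˣ) : ℕ → SiteZ d → SiteZ d → 𝔸ˣ :=
  fun j y x => axialFn (avgIterZ L U₀ j) ((L : ℤ) • y) x

/-- Unfolding `bgTZ`. [cite: Balaban1985Averaging, (78) p.30] -/
theorem bgTZ_apply (L : ℕ) (U₀ : SiteZ d → Fin d → 𝔸ˣ) (j : ℕ) (y x : SiteZ d) :
    bgTZ L U₀ j y x = axialFn (avgIterZ L U₀ j) ((L : ℤ) • y) x := rfl

end BlockingZ

/-! ## §10 The GUARDED (78)–(80) of record (for the R7 bridge to `Node00.ShearedAveragingFlat.gaugeAvgIter (loopAvgBlockOp expMeanLogSU)`) -/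

section GuardedGauge

variable {𝔸 : Type*} [NormedRing 𝔸] [NormedAlgebra ℂ 𝔸] [CompleteSpace 𝔸] (L : ℕ)

open B7SectCDGaugeAveragesRec (SexpZ savgZ)
open BlockAveragingZd (avgIterZG)

open scoped Classical in
/-- **The site average (78) AS OF RECORD (guarded)**: `{g(x)}_{x∈B(y)} = g(y)·ℰ{g(y)⁻¹g(x)}` with NODE 00's guarded inner average (`loopAvgBlockOp
expMeanLogSU` = `ESU` over the centred block: `exp[mean log]` if every `‖g(y)⁻¹g(x) − 1‖ < δ`, else `1`); on the guard it is `savgZ`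
(`savgZG_eq_savgZ_of_small`). [cite: Balaban1985Averaging, (78) p.30; Balaban1987RG1, (0.4) p.253] -/
def savgZG (δ : ℝ) (g : SiteZ d → 𝔸ˣ) (y : SiteZ d) : 𝔸ˣ :=
  g y * (if ∀ r : Fin d → Fin L, ‖((((g y)⁻¹ * g (y + offZ L r) : 𝔸ˣ)) : 𝔸) - 1‖ < δ then expUnit (SexpZ L g y) else 1)

/-- ON THE GUARD the record's site average IS the unguarded (78). [cite: Balaban1985Averaging, (78) p.30; Balaban1987RG1, (0.4) p.253] -/
theorem savgZG_eq_savgZ_of_small {δ : ℝ} {g : SiteZ d → 𝔸ˣ} {y : SiteZ d}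
    (h : ∀ r : Fin d → Fin L, ‖((((g y)⁻¹ * g (y + offZ L r) : 𝔸ˣ)) : 𝔸) - 1‖ < δ) : savgZG L δ g y = savgZ L g y := by
  classical
  unfold savgZG
  rw [if_pos h]
  rfl

/-- **The twisted site average (78) AS OF RECORD (guarded)** at the background `V₀`. [cite: Balaban1985Averaging, (78) p.30] -/
def R0avgZG (δ : ℝ) (V₀ : SiteZ d → Fin d → 𝔸ˣ) (v : SiteZ d → 𝔸ˣ) (y : SiteZ d) : 𝔸ˣ := savgZG L δ (R0fun V₀ y v) y

/-- **(79)–(80) AS OF RECORD (guarded)**: the `j`-fold gauge-function average with the guarded site average at the guarded record backgrounds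
`avgIterZG` — the `ℤᵈ` text of `Node00.ShearedAveragingFlat.gaugeAvgIter (loopAvgBlockOp expMeanLogSU)` at `U₀ = 1` (where every background
average is `1`, `avgIterZG_one`). [cite: Balaban1985Averaging, (79)–(80) p.30; Balaban1987RG1, (0.4) p.253] -/
def uavgZG (δ : ℝ) (U₀ : SiteZ d → Fin d → 𝔸ˣ) (u : SiteZ d → 𝔸ˣ) : ℕ → SiteZ d → 𝔸ˣ
  | 0 => u
  | j + 1 => fun z => R0avgZG L δ (avgIterZG L δ U₀ j) (uavgZG δ U₀ u j) ((L : ℤ) • z)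

/-- `\overline{R₀u}^0 = u` (guarded edition). [cite: Balaban1985Averaging, (79) p.30] -/
@[simp] theorem uavgZG_zero (δ : ℝ) (U₀ : SiteZ d → Fin d → 𝔸ˣ) (u : SiteZ d → 𝔸ˣ) : uavgZG L δ U₀ u 0 = u := rfl

/-- The recursion (80), guarded edition. [cite: Balaban1985Averaging, (80) p.30] -/
theorem uavgZG_succ (δ : ℝ) (U₀ : SiteZ d → Fin d → 𝔸ˣ) (u : SiteZ d → 𝔸ˣ) (j : ℕ) (z : SiteZ d) :
    uavgZG L δ U₀ u (j + 1) z = R0avgZG L δ (avgIterZG L δ U₀ j) (uavgZG L δ U₀ u j) ((L : ℤ) • z) := rfl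

end GuardedGauge

end Literature.MathematicalPhysics.QuantumFieldTheory.Balaban1983to89.B7SectEFLinearisationRec
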